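import Summits.NavierStokesRegularity.NavierStokesRegularity.Theorems.ScarRigidity.Negative.LogicAndLoadBearing
import HarnessLib

/-!
# `ScarRigidity` (crux stmt-NavierStokesRegularity-11717, route RellichScar): vacuity of the small-constant
# slices below a Liouville threshold — negative-side support (cdisprove seat, cycle 4)

The crux `Summit.NavierStokesRegularity.NavierStokesRegularity.Theses.RellichScar.ScarRigidity` is the family of
its slices `ScarRigidityAt C` (`Negative/LogicAndLoadBearing`: `scarRigidity_iff_forall_at`; only `0 < C` carries
content).  This file records, sorry-free, the LOGIC by which a small-data Liouville theorem empties the slices below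
its threshold, and the threshold that the Oseen-kernel contraction actually gives:

* `ApexLiouville C₀` — "every apex-class flow (suitable weak Navier–Stokes on the backward slab, weak spatial
  gradient, `𝐈 < ∞`, `|u(t,x)| ≤ C/(|x|+√(−t))`) with constant `C < C₀` vanishes a.e. on the slab";
* `scarRigidityAt_of_apexLiouville : ApexLiouville C₀ → C < C₀ → ScarRigidityAt C` (the first flow of any
  instance would be backward-singular at the origin and a.e. zero at once — `not_isBackwardSingularPoint_of_ae_zero`);
* `scarRigidity_iff_above_liouville : ApexLiouville C₀ → (ScarRigidity ↔ ∀ C, C₀ ≤ C → ScarRigidityAt C)`;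
* `bootstrap_eq_zero` — the one-line real inequality behind every contraction-Liouville theorem
  (`0 ≤ A ≤ κA²`, `κA < 1 ⇒ A = 0`).

## The number (paper + numerics; crux work file `Cruxes/ScarRigidity/Disproof.lean` §8, evidence
`liouville-vacuity.md`, kit job j010409)

`ApexLiouville C₀` holds with `C₀ = 1/κ♯ ≈ 1.16` modulo (i) the Oseen-mild representative of an apex-class flow
(stub `stub_apexMildRepresentative` of line finite-energy-log-convexity, KNSS 2009 §4) and (ii) a numerically
certified kernel constant.  Sketch: with `Φ = 1/(|x|+√(−t))` and `A = sup |u|/Φ ≤ C`, ancientness and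
`‖u(t₀)‖_∞ ≤ C/√(−t₀) → 0` give `u = −B(u,u)` (Oseen's bilinear Duhamel term from `−∞`); for every unit `n`,
`n·B(u,u) = ∫∫ uᵀQ⁽ⁿ⁾u` with `Q⁽ⁿ⁾ⱼₖ = Σᵢ nᵢ∂ₖ𝒪ᵢⱼ` (`𝒪` = Oseen tensor), so
`|u| ≤ A² supₙ ∫∫ λ_max⁺(sym Q⁽ⁿ⁾) Φ² ≤ κ♯ A² Φ`,
`κ♯ = sup_x supₙ (|x|+1)∫₀^∞ s^{−1/2}∫ λ_max⁺(sym Q⁽ⁿ⁾(1,η))(|x−√s η|+√(1+s))⁻² dη ds = 0.8594…`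
(attained at `|x| ≈ 11√(−t)`, `n = −x/|x|`; the crude kernel — max over directions of the full vector — gives
`1.428`, i.e. only `C < 0.700`).  Hence `A ≤ κ♯A²`, and `A = 0` for `C < 1/κ♯ ≈ 1.163` (`bootstrap_eq_zero`).

## Meaning for provers

1. `ScarRigidityAt C` is VACUOUS for every `C < 1.16`: below that constant there is no nonzero apex-class flow,
   let alone a singular one.  In particular the regime `2C² < 1` (`C < 0.7071`) of the picked line's threshold stub
   `stub_logConvexityBelowThreshold` contains only `V₁ = V₂ = 0`; the line's theorem-sized output
   ("ScarRigidity for `2C² < 1`") proves nothing that Liouville does not, and the content of the crux starts at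
   `C ≥ 1.16` at the earliest — inside the residual `stub_noAnomalousExtinction` (= the crux, see
   `Cruxes/ScarRigidity/DrefuteS5Costume.lean`).
2. A tree proof of `ApexLiouville 1.16` needs an EXPLICIT Oseen-gradient kernel bound (the tree's
   `exists_norm_oseenKernel_le` is existential); for `C < 0.7071` a crude explicit bound suffices (`κ < √2`
   needed against `κ♯ = 0.86`), for `C < 1.16` the quadratic-form (`λ_max`) refinement is required.
3. The `√(−t)` in the apex bound is what the Liouville argument uses (boundedness at the apex axis for `t < 0`):
   Landau's `−1`-homogeneous steady flows have arbitrarily small `sup |x||U|` and are excluded only by it.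

## References

* G. Koch, N. Nadirashvili, G. Seregin, V. Šverák, Acta Math. 203 (2009) 83–105 (mild ancient solutions, §4).
* V. A. Solonnikov, Trudy Mat. Inst. Steklov 70 (1964) 213–317 (Oseen tensor `Γδᵢⱼ + ∂ᵢ∂ⱼ(Γ ∗ (4π|x|)⁻¹)`).
* Crux work file `Summits/NavierStokesRegularity/NavierStokesRegularity/Cruxes/ScarRigidity/Disproof.lean`, §8.
-/

noncomputable section

open Set Filter Function MeasureTheory Metric TopologicalSpace
open scoped Topology ENNReal NNReal InnerProductSpace RealInnerProductSpace

set_option linter.dupNamespace false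

namespace Summit.NavierStokesRegularity.NavierStokesRegularity.Theorems.ScarRigidity.Negative

open Literature.Analysis.FluidPDE
open Summit.NavierStokesRegularity.NavierStokesRegularity.Theses.RellichScar

/-- Physical space. -/
local notation "ℝ³" => EuclideanSpace ℝ (Fin 3)

/-- The open backward slab `(-∞,0) × ℝ³` (time first). -/
local notation "𝕊" => slab (EuclideanSpace ℝ (Fin 3)) (Iio (0 : ℝ)) isOpen_Iio

/-- **THE BOOTSTRAP** behind every contraction-Liouville theorem: `0 ≤ A`, `A ≤ κA²` and `κA < 1` force
`A = 0`. [folklore] -/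
theorem bootstrap_eq_zero {A κ : ℝ} (hA : 0 ≤ A) (hκA : κ * A < 1) (h : A ≤ κ * A ^ 2) : A = 0 := by
  nlinarith [mul_nonneg hA (sub_nonneg.2 hκA.le)]

/-- **APEX LIOUVILLE at threshold `C₀`**: every apex-class flow — suitable weak Navier–Stokes solution on the
backward slab with a weak spatial gradient, `𝐈 < ∞` and the apex Type-I bound `|u(t,x)| ≤ C/(|x|+√(−t))` — of
constant `C < C₀` vanishes a.e. on the slab.  True for `C₀ = 1/κ♯ ≈ 1.16` modulo the mild representative and the
numerically certified kernel constant (module docstring); an open conjecture (Liouville, KNSS 2009) for every `C₀`. -/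
def ApexLiouville (C₀ : ℝ) : Prop :=
  ∀ (u : ℝ → ℝ³ → ℝ³) (p : ℝ → ℝ³ → ℝ) (G : ℝ → ℝ³ → ℝ³ →L[ℝ] ℝ³) (C : ℝ), C < C₀ →
    IsSuitableWeakSolutionOn 𝕊 1 0 u p → HasWeakSpatialGradientOn 𝕊 u G →
    typeIBound (Iio (0 : ℝ) ×ˢ univ) u p G < ⊤ → HasTypeIDecay C u →
    uncurry u =ᵐ[volume.restrict (Iio (0 : ℝ) ×ˢ (univ : Set ℝ³))] 0

/-- A flow vanishing a.e. on the past slab is not backward-singular at the origin: `Q₁(0,0) ⊆ (−∞,0) × ℝ³`,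
so `ess sup_{Q₁(0,0)} |u| = 0 ≠ ∞`. [folklore] -/
theorem not_isBackwardSingularPoint_of_ae_zero {u : ℝ → ℝ³ → ℝ³}
    (h : uncurry u =ᵐ[volume.restrict (Iio (0 : ℝ) ×ˢ (univ : Set ℝ³))] 0) :
    ¬ IsBackwardSingularPoint u 0 := by
  intro hs
  have h1 := hs 1 one_pos
  have hsub : parabolicCylinder 1 (0 : ℝ × ℝ³) ⊆ Iio (0 : ℝ) ×ˢ (univ : Set ℝ³) := by
    intro w hw
    rw [mem_parabolicCylinder] at hw
    exact mk_mem_prod (by simpa using hw.1.2) (mem_univ _)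
  have hae : uncurry u =ᵐ[volume.restrict (parabolicCylinder 1 (0 : ℝ × ℝ³))] 0 :=
    ae_restrict_of_ae_restrict_of_subset hsub h
  rw [eLpNorm_congr_ae hae, eLpNorm_zero] at h1
  exact ENNReal.zero_ne_top h1

/-- **VACUITY BELOW A LIOUVILLE THRESHOLD**: if the apex class is trivial for constants `< C₀`, every slice
`ScarRigidityAt C` with `C < C₀` holds — vacuously: the first flow of any instance would be backward-singular at
the origin and a.e. zero at once.  With `C₀ ≈ 1.16` this covers the whole regime `2C² < 1` of the picked line's
threshold stub and more. -/
theorem scarRigidityAt_of_apexLiouville {C₀ C : ℝ} (h : ApexLiouville C₀) (hC : C < C₀) :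
    ScarRigidityAt C := by
  intro u₁ p₁ G₁ u₂ p₂ G₂ hs₁ hg₁ hI₁ hd₁ _ _ _ _ hsing₁ _ _
  exact absurd hsing₁ (not_isBackwardSingularPoint_of_ae_zero (h u₁ p₁ G₁ C hC hs₁ hg₁ hI₁ hd₁))

/-- **The crux splits at any Liouville threshold**: below it nothing is to be proved, so `ScarRigidity` is
equivalent to its slices `C₀ ≤ C`. -/
theorem scarRigidity_iff_above_liouville {C₀ : ℝ} (h : ApexLiouville C₀) :
    ScarRigidity ↔ ∀ C : ℝ, C₀ ≤ C → ScarRigidityAt C := by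
  rw [scarRigidity_iff_forall_at]
  refine ⟨fun hall C _ => hall C, fun habove C => ?_⟩
  rcases lt_or_ge C C₀ with hC | hC
  · exact scarRigidityAt_of_apexLiouville h hC
  · exact habove C hC

/-- The TARGET restricted to small constants follows from the same Liouville statement: no singular apex profile
has constant `< C₀`. -/
theorem noApexTypeIProfile_below_of_apexLiouville {C₀ : ℝ} (h : ApexLiouville C₀) :
    ∀ (u : ℝ → ℝ³ → ℝ³) (p : ℝ → ℝ³ → ℝ) (G : ℝ → ℝ³ → ℝ³ →L[ℝ] ℝ³) (C : ℝ), C < C₀ →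
      IsSuitableWeakSolutionOn 𝕊 1 0 u p → HasWeakSpatialGradientOn 𝕊 u G →
      typeIBound (Iio (0 : ℝ) ×ˢ univ) u p G < ⊤ → HasTypeIDecay C u → ¬ IsBackwardSingularPoint u 0 :=
  fun u p G C hC hs hg hI hd => not_isBackwardSingularPoint_of_ae_zero (h u p G C hC hs hg hI hd)

end Summit.NavierStokesRegularity.NavierStokesRegularity.Theorems.ScarRigidity.Negative

end
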